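import Summits.Ventures.PercRepro.RankLevelSetAbsorbStarFourExcess
import Summits.Ventures.PercRepro.RankLevelSetPerElemThreeGood

/-! # RankLevelSetAbsorbStarFourEleven — THE STEP `k = 4` OF (ABS-star) ON EVERY COLOOP-FREE MATROID WITH AT
LEAST `11` ELEMENTS (night-1 g36; dossier §48.10; on `RankLevelSetAbsorbStarFourExcess` and
`RankLevelSetPerElemThreeGood`)

g34's uniform charging (`absorbStar_step_of_sq`: each member `Z ∈ A^y_k` spreads weight `1` evenly over its
`#E − (k + 1) − ex(Z)` up-neighbours) proves the step `k` for `#E ≥ k² − k + 1`, i.e. `k = 4` for `#E ≥ 13`. The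
per-`W` bound improves by the structural fact `card_downNbrs_le_two_of_two_excess` (a member `W ∈ A^y_5` with three
down-neighbours has at most one of excess `2`): with g34's `card_downNbrs_le` (`≤ 3` down-neighbours),
`card_exFinset_le` (excess `≤ 3`) and `downNbrs_eq_singleton_of_full_excess` (excess `3` ⟹ a single down-neighbour),
the weights `1 / (#E − 5 − ex)` of the down-neighbours of `W` sum to at most `1/(n − 7) + 2/(n − 6) ≤ 4/(n − 5)` for
`n ≥ 11` (**`sum_wtk_downNbrs_le_four`**), and the double count of `absorbStar_step_of_sq` gives
**`absorbStar_step_four_of_coloopFree : (∀ e, ¬ IsColoop e) → (∀ z ≠ y, y ∉ cl {z}) → 11 ≤ #E → (#E − 5)·A^y_4 ≤ 4·A^y_5`**,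
and with the loop and parallel cases (`absorbStar_step_four_of_parallel`) **`absorbStar_step_four_all_of_coloopFree`**
for every element. Every declaration has a docstring; imports: the cell's own modules and Mathlib only. Axioms:
standard. -/

namespace PercRepro

open Set Matroid

variable {α : Type} [DecidableEq α] (M : Matroid α) [M.Finite]

/-! ## The per-`W` bound at level `4 → 5` for `#E ≥ 11` -/

/-- **The per-`W` bound for `k = 4`, `11 ≤ #E`, coloop-free `M`**: the weights of the down-neighbours of a member
`W` at level `5` sum to at most `4 / (#E − 5)`. -/
lemma sum_wtk_downNbrs_le_four (hcol : ∀ e, ¬ M.IsColoop e) {y : α} (hy : y ∈ M.E)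
    (hnp : ∀ z, z ≠ y → y ∉ M.closure {z}) (hn : 11 ≤ M.E.ncard) {W : Finset α}
    (hW : W ∈ absorbFinset M y 5) :
    ∑ Z ∈ downNbrs M y 4 W, wtk M y 4 Z ≤ (4 : ℚ) / ((M.E.ncard : ℚ) - 5) := by
  set n := M.E.ncard with hn'
  have hnq : (11 : ℚ) ≤ (n : ℚ) := by exact_mod_cast hn
  have hpos5 : (0 : ℚ) < (n : ℚ) - 5 := by linarith
  have hpos6 : (0 : ℚ) < (n : ℚ) - 6 := by linarith
  have hpos7 : (0 : ℚ) < (n : ℚ) - 7 := by linarith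
  have hpos8 : (0 : ℚ) < (n : ℚ) - 8 := by linarith
  have hdle := card_downNbrs_le M hy hnp hW
  -- the weight of a down-neighbour with excess `c` is `1 / (n − 5 − c)`
  have hwt : ∀ Z ∈ downNbrs M y 4 W, wtk M y 4 Z = 1 / ((n : ℚ) - 5 - ((exFinset M y Z).card : ℚ)) := by
    intro Z hZ
    have hZA : Z ∈ absorbFinset M y 4 := (Finset.mem_filter.mp hZ).1
    have h1 := card_upNbrs_eq M hy hZA
    have h2 := card_exFinset_le M hy hZA
    rw [wtk]
    congr 1
    have : ((upNbrs M y 4 Z).card : ℚ) + (5 + ((exFinset M y Z).card : ℚ)) = (n : ℚ) := by exact_mod_cast h1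
    linarith
  have hexle : ∀ Z ∈ downNbrs M y 4 W, (exFinset M y Z).card ≤ 3 := by
    intro Z hZ
    have := card_exFinset_le M hy ((Finset.mem_filter.mp hZ).1)
    omega
  rcases Nat.lt_or_ge (downNbrs M y 4 W).card 1 with h0 | h1
  · have : downNbrs M y 4 W = ∅ := Finset.card_eq_zero.mp (by omega)
    rw [this, Finset.sum_empty]; positivity
  rcases Nat.lt_or_ge (downNbrs M y 4 W).card 2 with h1' | h2
  · -- one down-neighbour: weight `≤ 1/(n − 8) ≤ 4/(n − 5)`
    obtain ⟨Z, hZeq⟩ := Finset.card_eq_one.mp (by omega : (downNbrs M y 4 W).card = 1)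
    have hZ : Z ∈ downNbrs M y 4 W := by rw [hZeq]; simp
    rw [hZeq, Finset.sum_singleton, hwt Z hZ]
    have hc : ((exFinset M y Z).card : ℚ) ≤ 3 := by exact_mod_cast hexle Z hZ
    calc (1 : ℚ) / ((n : ℚ) - 5 - ((exFinset M y Z).card : ℚ)) ≤ 1 / ((n : ℚ) - 8) :=
          one_div_le_one_div_of_le hpos8 (by linarith)
      _ ≤ 4 / ((n : ℚ) - 5) := by rw [div_le_div_iff₀ hpos8 hpos5]; nlinarith
  -- two or more down-neighbours: no excess `3`
  have hex2 : ∀ Z ∈ downNbrs M y 4 W, (exFinset M y Z).card ≤ 2 := by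
    intro Z hZ
    by_contra h3
    have hfull : (exFinset M y Z).card + 1 = 4 := by have := hexle Z hZ; omega
    have := downNbrs_eq_singleton_of_full_excess M hy hW hZ hfull
    rw [this, Finset.card_singleton] at h2
    omega
  rcases Nat.lt_or_ge (downNbrs M y 4 W).card 3 with h2' | h3
  · -- exactly two: each weight `≤ 1/(n − 7)`, and `2/(n − 7) ≤ 4/(n − 5)`
    have hbound : ∀ Z ∈ downNbrs M y 4 W, wtk M y 4 Z ≤ 1 / ((n : ℚ) - 7) := by
      intro Z hZ
      rw [hwt Z hZ]
      have hc : ((exFinset M y Z).card : ℚ) ≤ 2 := by exact_mod_cast hex2 Z hZ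
      exact one_div_le_one_div_of_le hpos7 (by linarith)
    calc ∑ Z ∈ downNbrs M y 4 W, wtk M y 4 Z ≤ ∑ _Z ∈ downNbrs M y 4 W, (1 / ((n : ℚ) - 7)) :=
          Finset.sum_le_sum hbound
      _ = ((downNbrs M y 4 W).card : ℚ) * (1 / ((n : ℚ) - 7)) := by rw [Finset.sum_const, nsmul_eq_mul]
      _ = 2 * (1 / ((n : ℚ) - 7)) := by
          have : (downNbrs M y 4 W).card = 2 := by omega
          rw [this]; norm_num
      _ ≤ 4 / ((n : ℚ) - 5) := by
          rw [mul_one_div, div_le_div_iff₀ hpos7 hpos5]; nlinarith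
  · -- exactly three: at most one has excess `2`
    have hcard3 : (downNbrs M y 4 W).card = 3 := by omega
    have hsplit : ∑ Z ∈ downNbrs M y 4 W, wtk M y 4 Z =
        ∑ Z ∈ (downNbrs M y 4 W).filter (fun Z => (exFinset M y Z).card = 2), wtk M y 4 Z +
          ∑ Z ∈ (downNbrs M y 4 W).filter (fun Z => ¬ (exFinset M y Z).card = 2), wtk M y 4 Z :=
      (Finset.sum_filter_add_sum_filter_not _ _ _).symm
    have hcardD : ((downNbrs M y 4 W).filter (fun Z => (exFinset M y Z).card = 2)).card +
        ((downNbrs M y 4 W).filter (fun Z => ¬ (exFinset M y Z).card = 2)).card = 3 := by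
      rw [Finset.card_filter_add_card_filter_not, hcard3]
    obtain ⟨D2, hD2⟩ : ∃ D2, D2 = (downNbrs M y 4 W).filter (fun Z => (exFinset M y Z).card = 2) := ⟨_, rfl⟩
    obtain ⟨D1, hD1⟩ : ∃ D1, D1 = (downNbrs M y 4 W).filter (fun Z => ¬ (exFinset M y Z).card = 2) := ⟨_, rfl⟩
    rw [← hD2, ← hD1] at hsplit hcardD
    have hD2le : D2.card ≤ 1 := by
      by_contra hgt
      push Not at hgt
      obtain ⟨Z₁, hZ₁, Z₂, hZ₂, hne⟩ := Finset.one_lt_card.mp hgt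
      rw [hD2, Finset.mem_filter] at hZ₁ hZ₂
      have := card_downNbrs_le_two_of_two_excess M hcol hy (by omega) hW hZ₁.1 hZ₂.1 hne hZ₁.2 hZ₂.2
      omega
    have hb2 : ∀ Z ∈ D2, wtk M y 4 Z ≤ 1 / ((n : ℚ) - 7) := by
      intro Z hZ
      rw [hD2, Finset.mem_filter] at hZ
      rw [hwt Z hZ.1, hZ.2]
      exact le_of_eq (by push_cast; ring)
    have hb1 : ∀ Z ∈ D1, wtk M y 4 Z ≤ 1 / ((n : ℚ) - 6) := by
      intro Z hZ
      rw [hD1, Finset.mem_filter] at hZ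
      rw [hwt Z hZ.1]
      have hc1 : (exFinset M y Z).card ≤ 1 := by have := hex2 Z hZ.1; omega
      have hc : ((exFinset M y Z).card : ℚ) ≤ 1 := by exact_mod_cast hc1
      exact one_div_le_one_div_of_le hpos6 (by linarith)
    have hs2 : ∑ Z ∈ D2, wtk M y 4 Z ≤ (D2.card : ℚ) * (1 / ((n : ℚ) - 7)) := by
      calc ∑ Z ∈ D2, wtk M y 4 Z ≤ ∑ _Z ∈ D2, (1 / ((n : ℚ) - 7)) := Finset.sum_le_sum hb2
        _ = (D2.card : ℚ) * (1 / ((n : ℚ) - 7)) := by rw [Finset.sum_const, nsmul_eq_mul]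
    have hs1 : ∑ Z ∈ D1, wtk M y 4 Z ≤ (D1.card : ℚ) * (1 / ((n : ℚ) - 6)) := by
      calc ∑ Z ∈ D1, wtk M y 4 Z ≤ ∑ _Z ∈ D1, (1 / ((n : ℚ) - 6)) := Finset.sum_le_sum hb1
        _ = (D1.card : ℚ) * (1 / ((n : ℚ) - 6)) := by rw [Finset.sum_const, nsmul_eq_mul]
    have hD2q : (D2.card : ℚ) ≤ 1 := by exact_mod_cast hD2le
    have hD1q : (D1.card : ℚ) = 3 - (D2.card : ℚ) := by
      have : (D2.card : ℚ) + (D1.card : ℚ) = 3 := by exact_mod_cast hcardD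
      linarith
    have h67 : (1 : ℚ) / ((n : ℚ) - 6) ≤ 1 / ((n : ℚ) - 7) := one_div_le_one_div_of_le hpos7 (by linarith)
    rw [hsplit]
    calc ∑ Z ∈ D2, wtk M y 4 Z + ∑ Z ∈ D1, wtk M y 4 Z
        ≤ (D2.card : ℚ) * (1 / ((n : ℚ) - 7)) + (3 - (D2.card : ℚ)) * (1 / ((n : ℚ) - 6)) := by
          rw [← hD1q]; exact add_le_add hs2 hs1
      _ ≤ 1 * (1 / ((n : ℚ) - 7)) + 2 * (1 / ((n : ℚ) - 6)) := by
          have hD2nn : (0 : ℚ) ≤ (D2.card : ℚ) := by positivity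
          nlinarith [mul_le_mul_of_nonneg_left h67 hD2nn, one_div_pos.mpr hpos7, one_div_pos.mpr hpos6]
      _ ≤ 4 / ((n : ℚ) - 5) := by
          rw [one_mul, mul_one_div, div_add_div _ _ hpos7.ne' hpos6.ne', div_le_div_iff₀ (by positivity) hpos5]
          nlinarith

/-! ## The step `k = 4` for `#E ≥ 11` -/

/-- **THE STEP `k = 4` OF (ABS-star) ON A COLOOP-FREE MATROID AT AN ELEMENT IN NO PARALLEL PAIR, `11 ≤ #E`**:
`(#E − 5) · A^y_4 ≤ 4 · A^y_5` (g34 had `#E ≥ 13`). -/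
theorem absorbStar_step_four_of_coloopFree (hcol : ∀ e, ¬ M.IsColoop e) {y : α} (hy : y ∈ M.E)
    (hnp : ∀ z, z ≠ y → y ∉ M.closure {z}) (hn : 11 ≤ M.E.ncard) :
    (M.E.ncard - 5) * lowAbsorbCount M y 4 ≤ 4 * lowAbsorbCount M y 5 := by
  rw [lowAbsorbCount_eq_card, lowAbsorbCount_eq_card]
  set Ak := absorbFinset M y 4
  set Ak1 := absorbFinset M y 5
  set n := M.E.ncard with hn'
  have hnq : (11 : ℚ) ≤ (n : ℚ) := by exact_mod_cast hn
  have hposI : (0 : ℚ) < (n : ℚ) - 5 := by linarith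
  have hS : (Ak.card : ℚ) = ∑ W ∈ Ak1, ∑ Z ∈ downNbrs M y 4 W, wtk M y 4 Z := by
    calc (Ak.card : ℚ) = ∑ Z ∈ Ak, (1 : ℚ) := by simp
      _ = ∑ Z ∈ Ak, ∑ W ∈ Ak1, (if Z ⊆ W then wtk M y 4 Z else 0) :=
          Finset.sum_congr rfl (fun Z hZ => (sum_wtk_upNbrs M hy (by omega) hZ).symm)
      _ = ∑ W ∈ Ak1, ∑ Z ∈ Ak, (if Z ⊆ W then wtk M y 4 Z else 0) := Finset.sum_comm
      _ = ∑ W ∈ Ak1, ∑ Z ∈ downNbrs M y 4 W, wtk M y 4 Z :=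
          Finset.sum_congr rfl (fun W _ => by rw [downNbrs, Finset.sum_filter])
  have hle : (Ak.card : ℚ) ≤ (Ak1.card : ℚ) * ((4 : ℚ) / ((n : ℚ) - 5)) := by
    rw [hS]
    calc ∑ W ∈ Ak1, ∑ Z ∈ downNbrs M y 4 W, wtk M y 4 Z
        ≤ ∑ W ∈ Ak1, (4 : ℚ) / ((n : ℚ) - 5) :=
          Finset.sum_le_sum (fun W hW => sum_wtk_downNbrs_le_four M hcol hy hnp hn hW)
      _ = (Ak1.card : ℚ) * ((4 : ℚ) / ((n : ℚ) - 5)) := by rw [Finset.sum_const, nsmul_eq_mul]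
  have hq : ((n : ℚ) - 5) * (Ak.card : ℚ) ≤ 4 * (Ak1.card : ℚ) := by
    have := mul_le_mul_of_nonneg_left hle hposI.le
    rw [mul_comm (Ak1.card : ℚ), ← mul_assoc, mul_div_assoc', mul_comm ((n : ℚ) - 5) (4 : ℚ),
      mul_div_assoc, div_self hposI.ne', mul_one] at this
    linarith
  have hcast : (((n - 5 : ℕ)) : ℚ) = (n : ℚ) - 5 := by
    rw [Nat.cast_sub (by omega)]; push_cast; ring
  have hq' : (((n - 5) * Ak.card : ℕ) : ℚ) ≤ ((4 * Ak1.card : ℕ) : ℚ) := by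
    push_cast
    rw [hcast]
    exact hq
  exact_mod_cast hq'

/-- **THE STEP `k = 4` OF (ABS-star) ON EVERY COLOOP-FREE MATROID WITH `11 ≤ #E`, AT EVERY ELEMENT**: a loop
absorbs nothing, an element of a parallel pair is `absorbStar_step_four_of_parallel`, and an element in no parallel
pair is `absorbStar_step_four_of_coloopFree`. -/
theorem absorbStar_step_four_all_of_coloopFree (hcol : ∀ e, ¬ M.IsColoop e) {y : α} (hy : y ∈ M.E)
    (hn : 11 ≤ M.E.ncard) :
    (M.E.ncard - 5) * lowAbsorbCount M y 4 ≤ 4 * lowAbsorbCount M y 5 := by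
  by_cases hl : M.IsLoop y
  · rw [lowAbsorbCount_eq_zero_of_isLoop M hl 4, Nat.mul_zero]
    exact Nat.zero_le _
  by_cases hp : ∃ z, ParallelPair M y z
  · obtain ⟨z, hz⟩ := hp
    exact absorbStar_step_four_of_parallel M hz (by omega)
  simp only [not_exists] at hp
  exact absorbStar_step_four_of_coloopFree M hcol hy
    (fun z hz => notMem_closure_singleton_of_no_partner M hy hl hp hz) hn

end PercRepro
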